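import Summits.AnomalousDissipation.AnomalousDissipation.Theorems.MomentParityPathFunctionals

/-!
# Route MomentParity · `GalerkinEnsembleRealization` — the shift-invariant limit law on the
  trajectory space

Given shift-invariant probability measures `P j` on the compact metrizable trajectory space
`𝒦 = pathSpace R L` (the laws of the Galerkin ensembles at levels `N_j → ∞`) with resolved
dissipation `∫ F_d dP_j ≥ D` and truncated energies `∫ F_{e,T} dP_j ≤ E`, a subsequence converges
weakly (Prokhorov / Riesz: `ProbabilityMeasure 𝒦` is compact metrizable) to a probability measure
`Q` which is shift invariant, has `∫ F_d dQ ≥ D`, `∫ F_e dQ ≤ E` (monotone convergence in the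
truncation), and whose support is charged by the approximations: every neighbourhood of a point of
`supp Q` has positive `P j`-mass for infinitely many `j` (portmanteau)
(stmt-AnomalousDissipation-11466; Foias–Rosa–Temam 2013, Thm. 3.1).
-/

noncomputable section

set_option linter.dupNamespace false

open MeasureTheory Set Filter Topology Function Metric
open scoped BigOperators

namespace Summit.AnomalousDissipation.AnomalousDissipation.Theorems.MomentParity

open Literature.Analysis.FunctionSpaces Literature.Analysis.FunctionSpaces.Torus
open Literature.Analysis.FluidPDE Literature.Analysis.FluidPDE.Torus

variable {d : Type*} [Fintype d] [DecidableEq d] {R : ℝ} {L : (d → ℤ) → ℝ}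

/-- **The shift-invariant limit law.** See the module docstring. -/
theorem exists_shiftInvariant_limit (R : ℝ) (L : (d → ℤ) → ℝ) (ν : ℝ) (Kc : ℕ)
    (P : ℕ → Measure ↥(pathSpace (d := d) R L)) [hP : ∀ j, IsProbabilityMeasure (P j)]
    (hθ : ∀ j, (P j).map (pathShiftOn R L (pathShift_mapsTo R L)) = P j)
    {D E : ℝ} (hD : ∀ j, D ≤ ∫ ω, dissMean ν Kc ω.1 ∂(P j))
    (hE : ∀ j (T : Finset (d → ℤ)), ∫ ω, energyMeanTrunc T ω.1 ∂(P j) ≤ E) :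
    ∃ Q : Measure ↥(pathSpace (d := d) R L), IsProbabilityMeasure Q ∧
      Q.map (pathShiftOn R L (pathShift_mapsTo R L)) = Q ∧
      D ≤ ∫ ω, dissMean ν Kc ω.1 ∂Q ∧
      ∫ ω, energyMean ω.1 ∂Q ≤ E ∧
      ∀ ω ∈ Q.support, ∀ U ∈ 𝓝 ω, ∀ i : ℕ, ∃ j, i ≤ j ∧ 0 < P j U := by
  haveI : CompactSpace ↥(pathSpace (d := d) R L) := compactSpace_pathSpace R L
  -- the sequence in the compact metrizable space of probability measures
  set μs : ℕ → ProbabilityMeasure ↥(pathSpace (d := d) R L) := fun j => ⟨P j, hP j⟩ with hμs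
  obtain ⟨Qp, φ, hφ, hlim'⟩ := CompactSpace.tendsto_subseq μs
  have hlim : Tendsto (fun i => μs (φ i)) atTop (𝓝 Qp) := hlim'
  have hcoe : ∀ j, ((μs j : ProbabilityMeasure _) : Measure ↥(pathSpace (d := d) R L)) = P j := fun j => rfl
  refine ⟨Qp.toMeasure, inferInstance, ?_, ?_, ?_, ?_⟩
  · -- shift invariance passes to the limit
    have hc : Continuous (pathShiftOn (d := d) R L (pathShift_mapsTo R L)) := continuous_pathShiftOn R L
    have h1 := ProbabilityMeasure.tendsto_map_of_tendsto_of_continuous _ _ hlim hc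
    have h2 : (fun i => (μs (φ i)).map hc.measurable.aemeasurable) = fun i => μs (φ i) := by
      funext i
      apply ProbabilityMeasure.toMeasure_injective
      rw [ProbabilityMeasure.toMeasure_map]
      exact hθ (φ i)
    rw [h2] at h1
    have h3 := tendsto_nhds_unique h1 hlim
    have h4 := congrArg ProbabilityMeasure.toMeasure h3
    rw [ProbabilityMeasure.toMeasure_map] at h4
    exact h4
  · -- resolved dissipation: a bounded continuous functional
    set Fd : BoundedContinuousFunction ↥(pathSpace (d := d) R L) ℝ :=
      BoundedContinuousFunction.mkOfCompact ⟨fun ω => dissMean ν Kc ω.1, continuous_dissMean R L ν Kc⟩ with hFd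
    have h := (ProbabilityMeasure.tendsto_iff_forall_integral_tendsto.1 hlim) Fd
    exact ge_of_tendsto h (Eventually.of_forall fun i => hD (φ i))
  · -- energy: truncations are bounded continuous, then monotone convergence
    have htrunc : ∀ n : ℕ, ∫ ω, energyMeanTrunc (freqBall n) ω.1 ∂Qp.toMeasure ≤ E := by
      intro n
      set Fe : BoundedContinuousFunction ↥(pathSpace (d := d) R L) ℝ :=
        BoundedContinuousFunction.mkOfCompact ⟨fun ω => energyMeanTrunc (freqBall n) ω.1,
          continuous_energyMeanTrunc R L (freqBall n)⟩ with hFe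
      have h := (ProbabilityMeasure.tendsto_iff_forall_integral_tendsto.1 hlim) Fe
      exact le_of_tendsto h (Eventually.of_forall fun i => hE (φ i) (freqBall n))
    have hmono : Tendsto (fun n => ∫ ω, energyMeanTrunc (freqBall n) ω.1 ∂Qp.toMeasure) atTop
        (𝓝 (∫ ω, energyMean ω.1 ∂Qp.toMeasure)) := by
      refine integral_tendsto_of_tendsto_of_monotone (fun n => ?_) ?_ (ae_of_all _ fun ω m n hmn => ?_)
        (ae_of_all _ fun ω => tendsto_energyMeanTrunc ω.2)
      · exact (continuous_energyMeanTrunc R L (freqBall n)).integrable_of_hasCompactSupport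
          (HasCompactSupport.of_compactSpace _)
      · refine Integrable.of_bound (measurable_energyMean R L).aestronglyMeasurable (R ^ 2)
          (ae_of_all _ fun ω => ?_)
        rw [Real.norm_eq_abs, abs_of_nonneg (energyMean_mem_Icc ω.2).1]
        exact (energyMean_mem_Icc ω.2).2
      · exact intervalIntegral.integral_mono_on zero_le_one (intervalIntegrable_pathEnergy ω.2 _ 0 1)
          (intervalIntegrable_pathEnergy ω.2 _ 0 1) fun t _ => pathEnergy_mono (freqBall_mono hmn) ω.1 t
    exact le_of_tendsto' hmono htrunc
  · -- the support is charged by the approximations (portmanteau on open sets)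
    intro ω hω U hU i
    obtain ⟨V, hVU, hVo, hωV⟩ := mem_nhds_iff.1 hU
    have hpos : 0 < Qp.toMeasure V := (Measure.mem_support_iff_forall ω).1 hω V (hVo.mem_nhds hωV)
    have hlim_inf := ProbabilityMeasure.le_liminf_measure_open_of_tendsto hlim hVo
    have hfreq : ∃ᶠ n in atTop, 0 < (μs (φ n) : Measure _) V := by
      by_contra hcon
      rw [not_frequently] at hcon
      have h0 : liminf (fun n => (μs (φ n) : Measure _) V) atTop = 0 := by
        refine Filter.Tendsto.liminf_eq ?_
        refine tendsto_const_nhds.congr' ?_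
        filter_upwards [hcon] with n hn
        exact (le_zero_iff.1 (not_lt.1 hn)).symm
      rw [h0] at hlim_inf
      exact absurd hlim_inf (not_le.2 hpos)
    obtain ⟨n, hnpos, hn⟩ := (hfreq.and_eventually (eventually_ge_atTop i)).exists
    exact ⟨φ n, hn.trans (hφ.id_le n), hnpos.trans_le (measure_mono hVU)⟩

end Summit.AnomalousDissipation.AnomalousDissipation.Theorems.MomentParity
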